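import Mathlib
import Summits.ValiantsHypothesis.ValiantsHypothesis.Theorems.LacunarySymmetroidMatrixDescartesCensusRealExponentsSimplex
import Summits.ValiantsHypothesis.ValiantsHypothesis.Theorems.LacunarySymmetroidMatrixDescartesCensusRealExponentsLocus

/-!
# `MatrixDescartes` census — real exponents for ALL bounds: sign changes transfer, real certificates transfer, Sidon normal form

HONEST FRAMING.  Object-search cell `pub-symmetroid`, items `DoorA26 = PosRootLawAt 2 6 19`
(stmt-ValiantsHypothesis-19979) and `DoorA34 = PosRootLawAt 3 4 18` (stmt-ValiantsHypothesis-19980),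
OPEN, typed, never asserted; structure theorems for the real-exponent currency of
`…CensusRealExponentsDoors`, deciding neither.  Nothing here bears on `MatrixDescartes`
(stmt-ValiantsHypothesis-18050) or `VP ≠ VNP`.

The equivalence `posRootLawAt_iff_rpow` needs a SHARP bound (zeros ⇒ simple ⇒ sign changes).  Two of
its halves hold for EVERY bound `B` and are what the cell's rows actually use:

* `posRootLawAt_of_rpow`, `posRootLawOn_of_rpow` — **real-exponent certificates transfer to integer
  rows for every `B`** (specialise `δ = d`): a certificate bounding the zeros of `det ∑ x^{δ_l} S_l`
  uniformly on a real set of exponent vectors bounds every integer row `PosRootLawOn m K B d` with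
  `d` in that set — in particular for the `V = 19` rows (`B = 18`), where the converse is not claimed;
* `le_of_signChanges` — **integer rows bound SIGN CHANGES over real exponents for every `B`**: if
  `PosRootLawAt m K B` then no real-exponent pencil `∑ x^{δ_l} S_l` changes sign across more than `B`
  pairwise disjoint brackets `0 < a₁ < b₁ < a₂ < ⋯ < b_n` (persistence of brackets + lattice point +
  integer support, as in the sharp case, but with the brackets as INPUT — no multiplicity theory);
* `doorA26_iff_sidon_simplex` — the sharpest elementary normal form of the door: `DoorA26` iff no
  six-letter real symmetric `2 × 2` pencil whose exponent vector is a STRICTLY increasing 2-SIDON point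
  of the compact simplex (`0 = δ₀ < ⋯ < δ₅ = 1`, all pair sums distinct) has `20` zeros on `(0,∞)`
  (simplex normal form + Sidon confinement `realRow_two_six_of_pairSum_eq`).

[folklore] Continuity, intermediate value theorem, density of `(1/D)ℤ^K`; Laguerre via the kit.
-/

-- `Summit.ValiantsHypothesis.ValiantsHypothesis.…` repeats a component by the D-0017 layout
-- (single-conjunct summit), which the `dupNamespace` linter flags; the name is mandated.
set_option linter.dupNamespace false

namespace Summit.ValiantsHypothesis.ValiantsHypothesis.Theorems.LacunarySymmetroidMatrixDescartes.Census.RealExp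

open Finset Polynomial
open scoped BigOperators Matrix
open Summit.ValiantsHypothesis.ValiantsHypothesis.Theorems.MatrixDescartes.Negative (PosRootLawAt)
open Summit.ValiantsHypothesis.ValiantsHypothesis.Theorems.SymmetroidDescartes (eval_det_pencil)

section Transfer

variable {m K : ℕ}

/-- **Real-exponent bounds transfer to an integer row (every `B`).**  If every real symmetric pencil
on the integer support `d`, read with real powers `x^{(d_l : ℝ)}`, has at most `B` zeros on `(0,∞)`,
then `PosRootLawOn m K B d`. [folklore] -/
theorem posRootLawOn_of_rpow {B : ℕ} (d : Fin K → ℕ)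
    (h : ∀ (S : Fin K → Matrix (Fin m) (Fin m) ℝ), (∀ l, (S l).IsSymm) →
      {x : ℝ | 0 < x ∧ (∑ l, (x ^ ((d l : ℕ) : ℝ)) • S l).det = 0}.ncard ≤ B) :
    PosRootLawOn m K B d := by
  classical
  intro S hS
  set P : ℝ[X] := (∑ l, (X : ℝ[X]) ^ d l • (S l).map C).det with hP
  by_cases hP0 : P = 0
  · rw [hP0]; simp
  · have hset : (↑(P.roots.toFinset.filter (fun x => 0 < x)) : Set ℝ) =
        {x : ℝ | 0 < x ∧ (∑ l, (x ^ ((d l : ℕ) : ℝ)) • S l).det = 0} := by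
      ext x
      rw [Finset.coe_filter, Set.mem_setOf_eq, Set.mem_setOf_eq, Multiset.mem_toFinset,
        mem_roots hP0, IsRoot.def, hP, eval_det_pencil]
      simp only [Real.rpow_natCast]
      exact and_comm
    have h1 := h S hS
    rw [← hset, Set.ncard_coe_finset] at h1
    exact h1

/-- **Real-exponent rows imply integer rows (every `B`)** — the unconditional half of
`posRootLawAt_iff_rpow`. [folklore] -/
theorem posRootLawAt_of_rpow {B : ℕ}
    (h : ∀ (δ : Fin K → ℝ) (S : Fin K → Matrix (Fin m) (Fin m) ℝ), (∀ l, (S l).IsSymm) →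
      {x : ℝ | 0 < x ∧ (∑ l, (x ^ (δ l)) • S l).det = 0}.ncard ≤ B) :
    PosRootLawAt m K B :=
  fun d => posRootLawOn_of_rpow d (fun S hS => h (fun l => ((d l : ℕ) : ℝ)) S hS)

/-- **Brackets persist** under small perturbations of the exponent vector: if `det ∑_l e^{δ_l t} S_l`
takes values of opposite signs at the two ends of each of finitely many brackets, so does
`det ∑_l e^{δ'_l t} S_l` for every `δ'` in a ball around `δ`. [folklore] -/
theorem brackets_persist (δ : Fin K → ℝ) (S : Fin K → Matrix (Fin m) (Fin m) ℝ) {n : ℕ}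
    (a b : Fin n → ℝ)
    (hsign : ∀ i, (∑ l, Real.exp (δ l * a i) • S l).det * (∑ l, Real.exp (δ l * b i) • S l).det < 0) :
    ∃ r : ℝ, 0 < r ∧ ∀ δ' : Fin K → ℝ, dist δ' δ < r → ∀ i,
      (∑ l, Real.exp (δ' l * a i) • S l).det * (∑ l, Real.exp (δ' l * b i) • S l).det < 0 := by
  classical
  set U : Set (Fin K → ℝ) := {δ' | ∀ i, (∑ l, Real.exp (δ' l * a i) • S l).det *
    (∑ l, Real.exp (δ' l * b i) • S l).det < 0} with hU
  have hUopen : IsOpen U := by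
    have : U = ⋂ i, {δ' : Fin K → ℝ | (∑ l, Real.exp (δ' l * a i) • S l).det *
        (∑ l, Real.exp (δ' l * b i) • S l).det < 0} := by
      rw [hU]; ext δ'; simp only [Set.mem_setOf_eq, Set.mem_iInter]
    rw [this]
    exact isOpen_iInter_of_finite fun i =>
      isOpen_lt ((continuous_det_expPencil_exponents S (a i)).mul
        (continuous_det_expPencil_exponents S (b i))) continuous_const
  have hδU : δ ∈ U := by rw [hU]; exact hsign
  obtain ⟨r, hr, hball⟩ := Metric.isOpen_iff.mp hUopen δ hδU
  refine ⟨r, hr, fun δ' hδ' => ?_⟩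
  have h := hball (Metric.mem_ball.mpr hδ')
  rw [hU, Set.mem_setOf_eq] at h
  exact h

/-- **Integer rows bound sign changes over real exponents (every `B`).**  If `PosRootLawAt m K B`, then
for every real exponent vector `δ` and symmetric letters `S`, the function `t ↦ det ∑_l e^{δ_l t} S_l`
changes sign across at most `B` pairwise disjoint increasing brackets `a i < b i`.  (The brackets
persist on a ball of exponent vectors; a point of `(1/D)ℤ^K` in the ball gives, by `x = e^{t/D}` and a
monomial shift, an INTEGER support with `≥ n` distinct positive roots.) [folklore] -/
theorem le_of_signChanges {B : ℕ} (hlaw : PosRootLawAt m K B) (δ : Fin K → ℝ)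
    (S : Fin K → Matrix (Fin m) (Fin m) ℝ) (hS : ∀ l, (S l).IsSymm) {n : ℕ} (a b : Fin n → ℝ)
    (hab : ∀ i, a i < b i) (hdisj : ∀ i j, i < j → b i < a j)
    (hsign : ∀ i, (∑ l, Real.exp (δ l * a i) • S l).det * (∑ l, Real.exp (δ l * b i) • S l).det < 0) :
    n ≤ B := by
  classical
  rcases Nat.eq_zero_or_pos n with hn0 | hn0
  · omega
  obtain ⟨r, hr, hball⟩ := brackets_persist δ S a b hsign
  -- a point of `(1/D) ℤ^K` in the ball
  set D : ℕ := ⌈1 / r⌉₊ + 1 with hD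
  have hD0 : 0 < D := Nat.succ_pos _
  have hDpos : (0 : ℝ) < D := by exact_mod_cast hD0
  have hDr : 1 / (D : ℝ) < r := by
    have h1 : 1 / r < (D : ℝ) := by
      rw [hD]; push_cast
      exact (Nat.le_ceil (1 / r)).trans_lt (lt_add_one _)
    exact (one_div_lt hDpos hr).mpr h1
  set z : Fin K → ℤ := fun l => ⌊δ l * D⌋ with hz
  have hdist : dist (fun l => (z l : ℝ) / D) δ < r := by
    rw [dist_pi_lt_iff hr]
    intro l
    rw [Real.dist_eq]
    have h1 : (z l : ℝ) ≤ δ l * D := Int.floor_le _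
    have h2 : δ l * D < (z l : ℝ) + 1 := Int.lt_floor_add_one _
    have heq : (z l : ℝ) / D - δ l = ((z l : ℝ) - δ l * D) / D := by field_simp
    have h3 : |(z l : ℝ) / D - δ l| ≤ 1 / D := by
      rw [heq, abs_le]
      constructor
      · rw [le_div_iff₀ hDpos]
        have : -(1 / (D : ℝ)) * D = -1 := by field_simp
        rw [this]; linarith
      · exact div_le_div_of_nonneg_right (by linarith) hDpos.le
    exact h3.trans_lt hDr
  have hsign' := hball (fun l => (z l : ℝ) / D) hdist
  have hzeros : ∀ i, ∃ w ∈ Set.Ioo (a i) (b i),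
      (∑ l, Real.exp (((z l : ℝ) / D) * w) • S l).det = 0 :=
    fun i => exists_zero_of_mul_neg (hab i)
      (continuous_det_expPencil (fun l => (z l : ℝ) / D) S).continuousOn (hsign' i)
  choose w hwmem hw0 using hzeros
  have hwmono : StrictMono w := by
    intro i j hij
    have h1 := (hwmem i).2
    have h2 := (hwmem j).1
    have h3 := hdisj i j hij
    linarith
  obtain ⟨e, he⟩ := exists_nat_support z hD0 S
  set P : ℝ[X] := (∑ l, (X : ℝ[X]) ^ e l • (S l).map C).det with hP
  have hProot : ∀ i, P.eval (Real.exp (w i / D)) = 0 := fun i => by rw [hP, he]; exact hw0 i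
  have hPne : P ≠ 0 := by
    intro h0
    have h1 : P.eval (Real.exp (a ⟨0, hn0⟩ / D)) = 0 := by rw [h0, eval_zero]
    rw [hP, he] at h1
    have h2 := hsign' ⟨0, hn0⟩
    rw [h1, zero_mul] at h2
    exact lt_irrefl 0 h2
  set xs : Fin n → ℝ := fun i => Real.exp (w i / D) with hxs
  have hxsinj : Function.Injective xs := by
    intro i j hij
    have h1 := Real.exp_injective hij
    have h2 : w i = w j := by
      have h3 : w i / D * D = w j / D * D := by rw [h1]
      rwa [div_mul_cancel₀ _ hDpos.ne', div_mul_cancel₀ _ hDpos.ne'] at h3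
    exact hwmono.injective h2
  have hsub : univ.image xs ⊆ P.roots.toFinset.filter (fun x => 0 < x) := by
    intro x hx
    rw [Finset.mem_image] at hx
    obtain ⟨i, -, rfl⟩ := hx
    rw [Finset.mem_filter, Multiset.mem_toFinset, mem_roots hPne, IsRoot.def]
    exact ⟨hProot i, Real.exp_pos _⟩
  have hcard := Finset.card_le_card hsub
  rw [Finset.card_image_of_injective _ hxsinj, Finset.card_univ, Fintype.card_fin] at hcard
  have hle := hlaw e S hS
  rw [← hP] at hle
  omega

/-- The same in the variable `x > 0` (real powers): an integer row bounds the number of pairwise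
disjoint sign-change brackets `0 < a₁ < b₁ < a₂ < ⋯` of every real-exponent pencil
`x ↦ det ∑_l x^{δ_l} S_l`. [folklore] -/
theorem le_of_signChanges_rpow {B : ℕ} (hlaw : PosRootLawAt m K B) (δ : Fin K → ℝ)
    (S : Fin K → Matrix (Fin m) (Fin m) ℝ) (hS : ∀ l, (S l).IsSymm) {n : ℕ} (a b : Fin n → ℝ)
    (hpos : ∀ i, 0 < a i) (hab : ∀ i, a i < b i) (hdisj : ∀ i j, i < j → b i < a j)
    (hsign : ∀ i, (∑ l, ((a i) ^ (δ l)) • S l).det * (∑ l, ((b i) ^ (δ l)) • S l).det < 0) :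
    n ≤ B := by
  have hbpos : ∀ i, 0 < b i := fun i => (hpos i).trans (hab i)
  refine le_of_signChanges hlaw δ S hS (fun i => Real.log (a i)) (fun i => Real.log (b i))
    (fun i => Real.log_lt_log (hpos i) (hab i))
    (fun i j hij => Real.log_lt_log (hbpos i) (hdisj i j hij)) (fun i => ?_)
  have ha := det_rpowPencil_eq δ S (hpos i)
  have hb := det_rpowPencil_eq δ S (hbpos i)
  have h := hsign i
  rw [ha, hb] at h
  exact h

end Transfer

section SidonNormalForm

/-- **`DoorA26` on the open Sidon part of the compact simplex.**  `DoorA26` holds iff every six-letter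
real symmetric `2 × 2` pencil `∑_l x^{δ_l} S_l` whose exponent vector is STRICTLY increasing,
normalised (`δ₀ = 0`, `δ₅ = 1`) and 2-SIDON (all pair sums `δ_i + δ_j`, `i ≤ j`, distinct) has at most
`19` zeros on `(0,∞)`: the other points of the simplex carry no twenty by Sidon confinement
(`realRow_two_six_of_pairSum_eq`; a repeated exponent repeats a pair sum). [folklore] -/
theorem doorA26_iff_sidon_simplex :
    DoorA26 ↔ ∀ (δ : Fin 6 → ℝ), StrictMono δ → δ 0 = 0 → δ (Fin.last 5) = 1 →
      (∀ i j k l : Fin 6, i ≤ j → k ≤ l → (i, j) ≠ (k, l) → δ i + δ j ≠ δ k + δ l) →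
      ∀ (S : Fin 6 → Matrix (Fin 2) (Fin 2) ℝ), (∀ l, (S l).IsSymm) →
        {x : ℝ | 0 < x ∧ (∑ l, (x ^ (δ l)) • S l).det = 0}.ncard ≤ 19 := by
  classical
  rw [doorA26_iff_simplex]
  constructor
  · intro h δ hδ h0 h1 _ S hS
    exact h δ hδ.monotone h0 h1 S hS
  · intro h δ hmono h0 h1 S hS
    by_cases hsid : ∀ i j k l : Fin 6, i ≤ j → k ≤ l → (i, j) ≠ (k, l) → δ i + δ j ≠ δ k + δ l
    · -- a monotone 2-Sidon vector is strictly monotone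
      have hstrict : StrictMono δ := by
        refine hmono.strictMono_of_injective fun i j hij => ?_
        by_contra hne
        rcases lt_or_gt_of_ne hne with hlt | hlt
        · exact hsid i i i j le_rfl hlt.le (by simp [hlt.ne]) (by rw [hij]) 
        · exact hsid j j j i le_rfl hlt.le (by simp [hlt.ne]) (by rw [hij])
      exact h δ hstrict h0 h1 hsid S hS
    · push Not at hsid
      obtain ⟨i, j, k, l, hij, hkl, hne, hsum⟩ := hsid
      exact realRow_two_six_of_pairSum_eq δ hij hkl hne hsum S

end SidonNormalForm

end Summit.ValiantsHypothesis.ValiantsHypothesis.Theorems.LacunarySymmetroidMatrixDescartes.Census.RealExp
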